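import Summits.HubbardSuperconductivity.HubbardSuperconductivity.Theses.CooperSharpness

/-!
# Birth skeleton (BC3) of the crux `IncipientOrderPropagation` (stmt-HubbardSuperconductivity-19057; piece R of the
crux-strategist split of `CooperCoordinateGrowth`, stmt-HubbardSuperconductivity-12848)

SHARPNESS = NUCLEATION + MONOTONE PROPAGATION.  Two registered stubs and the kernel-checked composition
`IncipientOrderPropagation_of : stub_nucleation → stub_propagation → IncipientOrderPropagation`.

* `stub_nucleation` — MESOSCOPIC NUCLEATION just beyond a divergent-susceptibility coupling: if the torus `d`-wave
  pair susceptibility per site of every sector ground state of `H_L(U,g₀)` diverges along even `L`, then at the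
  coupling `g₀ + Δ` (any `Δ > 0`) the order density of every normalised sector ground state is super-`1/L`:
  `∀ A, eventually A/L ≤ θ_L(ψ)` (the Aizenman–Barsky mean-field bound `θ ≥ c·Δ` would give much more; only the
  mesoscopic shadow is asked).  Hardest stub (no fermionic differential inequality for `θ` in `g`).
* `stub_propagation` — QUASI-MONOTONICITY OF THE min-GS ORDER DENSITY IN THE ATTRACTIVE PAIR COUPLING (Griffiths-II
  analogue for ground states, uniform in `L`): a floor `t` on `θ_L` over all ground states at coupling `g` gives the
  floor `c·t` over all ground states at every `g' ∈ [g, 0]`, `c > 0` fixed (∃-quantified, not hand-picked).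
Both stubs are junk-free (only `θ_L = L⁻⁴ Re⟨ψ, pFᴴ pF ψ⟩ ∈ [0, 32]` of ground states appears), neither is the
crux (nucleation speaks of ONE coupling with a STRONGER floor; propagation has no divergence premise) nor the
summit (no LRO anywhere).  Sources: AizenmanBarsky1987 (Lemma 4.1/Thm 5.1 pattern: local criterion + propagation),
DuminilCopinTassionCMP2016, Griffiths1967 (second inequality), KomaTasaki1994.
-/

set_option linter.dupNamespace false

namespace Summit.HubbardSuperconductivity.HubbardSuperconductivity.Cruxes.IncipientOrderPropagation.Birth

open Summit.HubbardSuperconductivity.HubbardSuperconductivity.Theses.CooperSharpness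

/-! ### Stub statements, named (harness skeleton convention A12: the composition cites the stubs BY NAME) -/

/-- statement of `stub_nucleation` -/
def Sig.stub_nucleation : Prop :=
  ∃ U₀ : ℝ, 0 < U₀ ∧ ∃ γ : ℝ, 0 < γ ∧ ∀ U ∈ Set.Ioo (0:ℝ) U₀, ∀ δ ∈ Set.Ioo (0:ℝ) (1 / 2), ∀ g₀ ∈ Set.Ico (-γ) (0:ℝ), (∀ X : ℝ, ∃ L₁ : ℕ, ∀ (L : ℕ) [NeZero L], L₁ ≤ L → Even L → ∀ ψ : Literature.MathematicalPhysics.QuantumLattice.Fock (Literature.MathematicalPhysics.QuantumLattice.Orb (Literature.MathematicalPhysics.QuantumLattice.FermionTorus 2 L)), star ψ ⬝ᵥ ψ = 1 → Literature.MathematicalPhysics.QuantumLattice.IsGroundStateInSector (Literature.MathematicalPhysics.QuantumLattice.hubbardTorus 2 L 1 U - ((g₀ : ℝ) : ℂ) • (∑ x : Literature.Probability.LatticeModels.TorusSite 2 L, Matrix.conjTranspose (Literature.MathematicalPhysics.QuantumLattice.localPair Literature.MathematicalPhysics.QuantumLattice.dWaveFormFactor L x) * Literature.MathematicalPhysics.QuantumLattice.localPair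 Literature.MathematicalPhysics.QuantumLattice.dWaveFormFactor L x)) (2 * ⌊(1 - δ) * (L : ℝ) ^ 2 / 2⌋₊) 0 ψ → X ≤ Literature.MathematicalPhysics.QuantumLattice.torusPairSusceptibility (Literature.MathematicalPhysics.QuantumLattice.hubbardTorus 2 L 1 U - ((g₀ : ℝ) : ℂ) • (∑ x : Literature.Probability.LatticeModels.TorusSite 2 L, Matrix.conjTranspose (Literature.MathematicalPhysics.QuantumLattice.localPair Literature.MathematicalPhysics.QuantumLattice.dWaveFormFactor L x) * Literature.MathematicalPhysics.QuantumLattice.localPair Literature.MathematicalPhysics.QuantumLattice.dWaveFormFactor L x)) (Literature.MathematicalPhysics.QuantumLattice.pairField Literature.MathematicalPhysics.QuantumLattice.dWaveFormFactor L) (2 * ⌊(1 - δ) * (L : ℝ) ^ 2 / 2⌋₊) ψ / (L : ℝ) ^ 2) → ∀ Δ : ℝ, 0 < Δ → ∀ A : ℝ, ∃ L₁ : ℕ, ∀ (L : ℕ) [NeZero L], L₁ ≤ L → Even L → g₀ + Δ ≤ 0 → ∀ ψ : Literature.MathematicalPhysics.QuantumLattice.Fock (Literature.MathematicalPhysics.QuantumLattice.Orb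 (Literature.MathematicalPhysics.QuantumLattice.FermionTorus 2 L)), star ψ ⬝ᵥ ψ = 1 → Literature.MathematicalPhysics.QuantumLattice.IsGroundStateInSector (Literature.MathematicalPhysics.QuantumLattice.hubbardTorus 2 L 1 U - ((g₀ + Δ : ℝ) : ℂ) • (∑ x : Literature.Probability.LatticeModels.TorusSite 2 L, Matrix.conjTranspose (Literature.MathematicalPhysics.QuantumLattice.localPair Literature.MathematicalPhysics.QuantumLattice.dWaveFormFactor L x) * Literature.MathematicalPhysics.QuantumLattice.localPair Literature.MathematicalPhysics.QuantumLattice.dWaveFormFactor L x)) (2 * ⌊(1 - δ) * (L : ℝ) ^ 2 / 2⌋₊) 0 ψ → A / (L : ℝ) ≤ ((Literature.MathematicalPhysics.QuantumLattice.expect (Matrix.conjTranspose (Literature.MathematicalPhysics.QuantumLattice.pairField Literature.MathematicalPhysics.QuantumLattice.dWaveFormFactor L) * Literature.MathematicalPhysics.QuantumLattice.pairField Literature.MathematicalPhysics.QuantumLattice.dWaveFormFactor L) ψ).re / (L : ℝ) ^ 4)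

/-- statement of `stub_propagation` -/
def Sig.stub_propagation : Prop :=
  ∃ U₀ : ℝ, 0 < U₀ ∧ ∃ γ : ℝ, 0 < γ ∧ ∀ U ∈ Set.Ioo (0:ℝ) U₀, ∀ δ ∈ Set.Ioo (0:ℝ) (1 / 2), ∃ c : ℝ, 0 < c ∧ ∃ L₀ : ℕ, ∀ (L : ℕ) [NeZero L], L₀ ≤ L → Even L → ∀ g g' : ℝ, -γ ≤ g → g ≤ g' → g' ≤ 0 → ∀ t : ℝ, (∀ ψ : Literature.MathematicalPhysics.QuantumLattice.Fock (Literature.MathematicalPhysics.QuantumLattice.Orb (Literature.MathematicalPhysics.QuantumLattice.FermionTorus 2 L)), star ψ ⬝ᵥ ψ = 1 → Literature.MathematicalPhysics.QuantumLattice.IsGroundStateInSector (Literature.MathematicalPhysics.QuantumLattice.hubbardTorus 2 L 1 U - ((g : ℝ) : ℂ) • (∑ x : Literature.Probability.LatticeModels.TorusSite 2 L, Matrix.conjTranspose (Literature.MathematicalPhysics.QuantumLattice.localPair Literature.MathematicalPhysics.QuantumLattice.dWaveFormFactor L x) * Literature.MathematicalPhysics.QuantumLattice.localPair Literature.MathematicalPhysics.QuantumLattice.dWaveFormFactor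 L x)) (2 * ⌊(1 - δ) * (L : ℝ) ^ 2 / 2⌋₊) 0 ψ → t ≤ ((Literature.MathematicalPhysics.QuantumLattice.expect (Matrix.conjTranspose (Literature.MathematicalPhysics.QuantumLattice.pairField Literature.MathematicalPhysics.QuantumLattice.dWaveFormFactor L) * Literature.MathematicalPhysics.QuantumLattice.pairField Literature.MathematicalPhysics.QuantumLattice.dWaveFormFactor L) ψ).re / (L : ℝ) ^ 4)) → ∀ ψ' : Literature.MathematicalPhysics.QuantumLattice.Fock (Literature.MathematicalPhysics.QuantumLattice.Orb (Literature.MathematicalPhysics.QuantumLattice.FermionTorus 2 L)), star ψ' ⬝ᵥ ψ' = 1 → Literature.MathematicalPhysics.QuantumLattice.IsGroundStateInSector (Literature.MathematicalPhysics.QuantumLattice.hubbardTorus 2 L 1 U - ((g' : ℝ) : ℂ) • (∑ x : Literature.Probability.LatticeModels.TorusSite 2 L, Matrix.conjTranspose (Literature.MathematicalPhysics.QuantumLattice.localPair Literature.MathematicalPhysics.QuantumLattice.dWaveFormFactor L x) * Literature.MathematicalPhysics.QuantumLattice.localPair Literature.MathematicalPhysics.QuantumLattice.dWaveFormFactor L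 x)) (2 * ⌊(1 - δ) * (L : ℝ) ^ 2 / 2⌋₊) 0 ψ' → c * t ≤ ((Literature.MathematicalPhysics.QuantumLattice.expect (Matrix.conjTranspose (Literature.MathematicalPhysics.QuantumLattice.pairField Literature.MathematicalPhysics.QuantumLattice.dWaveFormFactor L) * Literature.MathematicalPhysics.QuantumLattice.pairField Literature.MathematicalPhysics.QuantumLattice.dWaveFormFactor L) ψ').re / (L : ℝ) ^ 4)

/-- stub (hardest): mesoscopic nucleation of `d`-wave order just beyond a divergent-susceptibility coupling. -/
theorem stub_nucleation : Sig.stub_nucleation := by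
  sorry

/-- stub: quasi-monotone propagation of a ground-state order floor to the right in the pair coupling. -/
theorem stub_propagation : Sig.stub_propagation := by
  sorry

/-- Composition (kernel-checked): nucleation at `g₀ + Δ` with amplitude `A := 1/c`, then propagation with factor
`c` to every `g ∈ [g₀ + Δ, 0]`, gives the crux's floor `1/L` uniformly. [folklore] -/
theorem IncipientOrderPropagation_of (hN : Sig.stub_nucleation) (hP : Sig.stub_propagation) : IncipientOrderPropagation := by
  obtain ⟨U₁, hU₁, γ₁, hγ₁, hN⟩ := hN
  obtain ⟨U₂, hU₂, γ₂, hγ₂, hP⟩ := hP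
  refine ⟨min U₁ U₂, lt_min hU₁ hU₂, min γ₁ γ₂, lt_min hγ₁ hγ₂, ?_⟩
  intro U hU δ hδ g₀ hg₀ hdiv Δ hΔ
  have hU1 : U ∈ Set.Ioo (0:ℝ) U₁ := ⟨hU.1, lt_of_lt_of_le hU.2 (min_le_left _ _)⟩
  have hU2 : U ∈ Set.Ioo (0:ℝ) U₂ := ⟨hU.1, lt_of_lt_of_le hU.2 (min_le_right _ _)⟩
  have hγ1 : min γ₁ γ₂ ≤ γ₁ := min_le_left _ _
  have hγ2 : min γ₁ γ₂ ≤ γ₂ := min_le_right _ _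
  have hg₀1 : g₀ ∈ Set.Ico (-γ₁) (0:ℝ) := ⟨by linarith [hg₀.1], hg₀.2⟩
  obtain ⟨c, hc, L₀, hprop⟩ := hP U hU2 δ hδ
  obtain ⟨L₁, hnuc⟩ := hN U hU1 δ hδ g₀ hg₀1 hdiv Δ hΔ (1 / c)
  refine ⟨max L₀ L₁, ?_⟩
  intro L _ hL hEven g hg hg0 ψ hψ hgs
  have hL₀ : L₀ ≤ L := le_of_max_le_left hL
  have hL₁ : L₁ ≤ L := le_of_max_le_right hL
  have h0 : g₀ + Δ ≤ 0 := le_trans hg hg0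
  have key := hprop L hL₀ hEven (g₀ + Δ) g (by linarith [hg₀.1]) hg hg0 ((1 / c) / (L : ℝ))
    (fun φ hφ hφs => hnuc L hL₁ hEven h0 φ hφ hφs) ψ hψ hgs
  have hcc : c * ((1 / c) / (L : ℝ)) = 1 / (L : ℝ) := by
    field_simp
  linarith [key, hcc]

/-- The skeleton in its final shape (A12): the crux BY NAME from the two registered stubs, no hypotheses; it depends on
`sorryAx` only through `stub_*` and becomes the crux proof when both stubs are discharged. [folklore] -/
theorem IncipientOrderPropagation_of_stubs : IncipientOrderPropagation :=
  IncipientOrderPropagation_of stub_nucleation stub_propagation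

end Summit.HubbardSuperconductivity.HubbardSuperconductivity.Cruxes.IncipientOrderPropagation.Birth
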